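import Summits.BirchSwinnertonDyer.BirchSwinnertonDyer.Theorems.CountingDoorF2AtThreeRootNumberSieve
import Summits.BirchSwinnertonDyer.BirchSwinnertonDyer.Theorems.CountingDoorF2AtThreeRootNumberClosedForm
import Literature.NumberTheory.EllipticCurves.BhargavaHo2022.LargeFamilyEulerProduct
import HarnessLib

/-!
# BirchSwinnertonDyer / CountingDoorF2AtThree — crux I2 `RootNumberPlusLowerDensityLargeF2`
# (stmt-BirchSwinnertonDyer-19441), lane «closed-form root numbers + squarefree sieve»: the
# squarefree-sieve tail DISCHARGED BY NAME — I2 from inputs on finitely-conditioned families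

Route `route-BirchSwinnertonDyer-CountingDoorF2AtThree` (cell bsd-rank2; TWIN leaf
`PAdicBSDRankTwoPositiveProportion`). The tree's sieve reduction for I2,
`Theorems.rootNumberPlusLowerDensityLargeF2_of_finiteConditions` (file
`CountingDoorF2AtThreeRootNumberSieve.lean`), concludes the route decl from (i) a UNIFORM lower
density `ρ₀ > 1/6` of `{w = +1}` on every subfamily of `F₂` with FINITELY many congruence conditions
and nonempty local conditions, (ii) an ad-hoc hypothesis `htail` (the `p² ∣ Δ` tail estimate), and
(iii) Bhargava–Ho's Thm. 9.1 in the tree's form `thm9_1_F2`. Both (ii) and (iii) are now COROLLARIES of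
ONE printed theorem — Bhargava–Ho's Thm. 9.1 for `F₂` WITH ITS EULER-PRODUCT CONSTANT, the named fact
`Literature.NumberTheory.EllipticCurves.BhargavaHo2022.thm9_1_F2_eulerProduct` (file
`BhargavaHo2022/LargeFamilyEulerProduct.lean`: `.tail_estimate` = `htail` verbatim, `.thm9_1` =
`thm9_1_F2`) — so this file restates the reduction with (ii)–(iii) DISCHARGED BY NAME, and adds the
two currencies in which an analytic input would actually arrive:

* `rootNumberPlusLowerDensityLargeF2_of_finiteConditions'` — I2 ⟸ (i), modulo the one printed fact;
* `rootNumberPlusLowerDensityLargeF2_of_uniformBias` — I2 ⟸ a uniform `2/3`-BIAS bound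
  `limsup_X avg_{Ψ(<X)}(−w) ≤ θ < 2/3` on every finitely-conditioned `Ψ` with nonempty local conditions
  (the weak-Chowla currency of the lane's census; gives `ρ = (1 − θ)/2 > 1/6`);
* `rootNumberPlusLowerDensityLargeF2_of_equidistribution` — I2 ⟸ root-number equidistribution
  (`limsup avg(−w) ≤ 0`) in height boxes with finitely many congruence conditions (`ρ = 1/2`);
* the converse direction is the tree's fact-free `rootNumberPlusLowerDensity_finiteConditions_of_largeF2`
  (finitely-conditioned families are large): modulo the one fact, I2 sits BETWEEN «∀ Ψ
  finitely-conditioned ∃ ρ > 1/6» (implied) and «∃ ρ₀ > 1/6 ∀ Ψ finitely-conditioned» (implies);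
* `rootNumberPlusLowerDensityLargeF2_of_tendsto_averageOn` — the same with `avg w → 0` as a limit.

HONEST STATUS: every hypothesis (i)/(bias)/(equidistribution) is OPEN — weak Chowla for the
irreducible quaternary weight-12 discriminant form of `F₂` (lane census: `IDEATION-CENSUS-r1-s1.md`,
`LANE-B-CENSUS-rootno-p2.md`); I2 is NOT proved; the theorems are `proof.conditional` on the named
fact and on that input. PARTITION: none — r_an ≥ 2, summit axis S0; TWIN (D-0056): n/a. B1 honesty:
counting bookkeeping; the root number enters only as a predicate on members; no analytic rank, no
`L`-value; no S0 motion.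

References: M. Bhargava, W. Ho, arXiv:2207.03309 (2022) §9.1 Thm. 9.1, Prop. 9.2 [BhargavaHo2022];
H. Helfgott, arXiv:math/0408141 (root numbers in families ⟸ Chowla-type + square-free-sieve
hypotheses) [Helfgott2004RootNumber]; M. Bhargava, A. Shankar, Ann. of Math. 181 (2015) §2.7
[BhargavaShankarAnnals2015].
-/

set_option linter.dupNamespace false

noncomputable section

open scoped Classical
open Filter Topology Finset
open Literature.NumberTheory.EllipticCurves.BhargavaHo2022
  Summit.BirchSwinnertonDyer.Rank2
  Summit.BirchSwinnertonDyer.BirchSwinnertonDyer.Theses.CountingDoorF2AtThree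

namespace Summit.BirchSwinnertonDyer.BirchSwinnertonDyer.Theorems

/-- **I2 from a uniform lower density on finitely-conditioned families**, modulo ONLY Bhargava–Ho's
Thm. 9.1 with its constant: if some `ρ₀ > 1/6` is a lower density of `{w = +1}` in EVERY subfamily of
`F₂` with finitely many congruence conditions and nonempty local conditions, then
`RootNumberPlusLowerDensityLargeF2` — the tree's `rootNumberPlusLowerDensityLargeF2_of_finiteConditions`
with its hypotheses `thm9_1_F2` and `htail` DISCHARGED by `thm9_1_F2_eulerProduct.thm9_1` and
`thm9_1_F2_eulerProduct.tail_estimate`. [cite: BhargavaHo2022, Thm. 9.1, Prop. 9.2 (§9.1, p. 31)] -/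
theorem rootNumberPlusLowerDensityLargeF2_of_finiteConditions' (h : thm9_1_F2_eulerProduct)
    (hfin : ∃ ρ₀ : ℝ, 1 / 6 < ρ₀ ∧ ∀ Ψ : CongruenceFamily₂,
      (∃ Y : ℕ, ∀ p : ℕ, Y ≤ p → Ψ.residues p = Set.univ) →
      (∀ p : ℕ, p.Prime → (Ψ.residues p).Nonempty) →
      Ψ.DensityOnGE (fun a ↦ a.curve.rootNumber = 1) ρ₀) :
    RootNumberPlusLowerDensityLargeF2 :=
  rootNumberPlusLowerDensityLargeF2_of_finiteConditions (thm9_1_F2_eulerProduct.thm9_1 h)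
    (thm9_1_F2_eulerProduct.tail_estimate h) hfin

/-- A large family with nonempty local conditions has eventually nonempty height balls, modulo
Thm. 9.1 with its constant (`#Φ(<X)/#F₂(<X) → c_Φ > 0` forces `#Φ(<X) > 0` eventually); cf. the
tree's `F2RootNumber.eventually_card_below_pos_of_isLarge` (same, from `thm9_1_F2`, in a module of the
route's cone). [cite: BhargavaHo2022, Thm. 9.1 (§9.1, p. 31)] -/
theorem eventually_card_below_pos_of_eulerProduct (h : thm9_1_F2_eulerProduct) (Φ : CongruenceFamily₂)
    (hL : Φ.IsLarge) (hne : ∀ p : ℕ, p.Prime → (Φ.residues p).Nonempty) :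
    ∀ᶠ X : ℕ in atTop, 0 < (Φ.below X).card := by
  obtain ⟨c, hc, -, ht⟩ := thm9_1_F2_eulerProduct.relativeDensity h Φ hL hne
  filter_upwards [ht.eventually (Ioi_mem_nhds (half_lt_self hc))] with X hX
  by_contra h0
  have h0' : (Φ.below X).card = 0 := Nat.eq_zero_of_not_pos h0
  rw [h0', Nat.cast_zero, zero_div] at hX
  linarith

/-- **I2 from a uniform `2/3`-bias bound on finitely-conditioned families**, modulo ONLY Thm. 9.1 with
its constant: if for some `θ < 2/3`, EVERY subfamily `Ψ ⊆ F₂` with finitely many congruence conditions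
and nonempty local conditions satisfies `limsup_X avg_{Ψ(<X)} (−w(E_a)) ≤ θ`
(`Ψ.AverageOnLE (fun a ↦ −w(E_a)) θ` — a bias bound for the root number in height boxes with
congruence conditions, the weak-Chowla currency of the lane's census), then
`RootNumberPlusLowerDensityLargeF2` (with `ρ = (1 − θ)/2 > 1/6` on every large family, through the
tree's `F2RootNumber.densityOnGE_rootNumber_of_averageOnLE`).
[cite: BhargavaHo2022, Thm. 9.1 (§9.1); Helfgott2004RootNumber, §1 (root numbers in families and Chowla-type hypotheses)] -/
theorem rootNumberPlusLowerDensityLargeF2_of_uniformBias (h : thm9_1_F2_eulerProduct)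
    (hbias : ∃ θ : ℝ, θ < 2 / 3 ∧ ∀ Ψ : CongruenceFamily₂,
      (∃ Y : ℕ, ∀ p : ℕ, Y ≤ p → Ψ.residues p = Set.univ) →
      (∀ p : ℕ, p.Prime → (Ψ.residues p).Nonempty) →
      Ψ.AverageOnLE (fun a ↦ -(a.curve.rootNumber : ℝ)) θ) :
    RootNumberPlusLowerDensityLargeF2 := by
  obtain ⟨θ, hθ, hΨ⟩ := hbias
  refine rootNumberPlusLowerDensityLargeF2_of_finiteConditions' h ⟨(1 - θ) / 2, by linarith, ?_⟩
  intro Ψ hfin hne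
  obtain ⟨Y, hY⟩ := hfin
  exact F2RootNumber.densityOnGE_rootNumber_of_averageOnLE Ψ
    (eventually_card_below_pos_of_eulerProduct h Ψ (isLarge_of_residues_eq_univ Ψ hY) hne)
    (hΨ Ψ ⟨Y, hY⟩ hne)

/-- **I2 from root-number equidistribution in congruence boxes**, modulo ONLY Thm. 9.1 with its
constant: if every subfamily of `F₂` with finitely many congruence conditions and nonempty local
conditions has `limsup_X avg_{Ψ(<X)} (−w(E_a)) ≤ 0` (in particular if the root number is
equidistributed, `avg w → 0`, in every height box with finitely many congruence conditions), then
`RootNumberPlusLowerDensityLargeF2` (with `ρ = 1/2`) — the `θ = 0` case of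
`rootNumberPlusLowerDensityLargeF2_of_uniformBias`. The hypothesis is OPEN (weak Chowla for the
discriminant form of `F₂`). [cite: Helfgott2004RootNumber, §1; BhargavaHo2022, Thm. 9.1] -/
theorem rootNumberPlusLowerDensityLargeF2_of_equidistribution (h : thm9_1_F2_eulerProduct)
    (heq : ∀ Ψ : CongruenceFamily₂,
      (∃ Y : ℕ, ∀ p : ℕ, Y ≤ p → Ψ.residues p = Set.univ) →
      (∀ p : ℕ, p.Prime → (Ψ.residues p).Nonempty) →
      Ψ.AverageOnLE (fun a ↦ -(a.curve.rootNumber : ℝ)) 0) :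
    RootNumberPlusLowerDensityLargeF2 :=
  rootNumberPlusLowerDensityLargeF2_of_uniformBias h ⟨0, by norm_num, heq⟩

/-- **Equidistribution as a limit** is the same input: if on every finitely-conditioned `Ψ` with
nonempty local conditions the average root number TENDS TO `0`, then `RootNumberPlusLowerDensityLargeF2`
(modulo the one printed fact). [cite: Helfgott2004RootNumber, §1; BhargavaHo2022, Thm. 9.1] -/
theorem rootNumberPlusLowerDensityLargeF2_of_tendsto_averageOn (h : thm9_1_F2_eulerProduct)
    (heq : ∀ Ψ : CongruenceFamily₂,
      (∃ Y : ℕ, ∀ p : ℕ, Y ≤ p → Ψ.residues p = Set.univ) →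
      (∀ p : ℕ, p.Prime → (Ψ.residues p).Nonempty) →
      Tendsto (Ψ.averageOn (fun a ↦ (a.curve.rootNumber : ℝ))) atTop (𝓝 0)) :
    RootNumberPlusLowerDensityLargeF2 := by
  refine rootNumberPlusLowerDensityLargeF2_of_equidistribution h fun Ψ hY hne ε hε ↦ ?_
  have hlim : Tendsto (Ψ.averageOn (fun a ↦ -(a.curve.rootNumber : ℝ))) atTop (𝓝 0) := by
    have hneg := (heq Ψ hY hne).neg
    rw [neg_zero] at hneg
    refine hneg.congr fun X ↦ ?_
    simp only [CongruenceFamily₂.averageOn, Finset.sum_neg_distrib, neg_div]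
  filter_upwards [hlim.eventually (Iio_mem_nhds (show (0 : ℝ) < 0 + ε by linarith))] with X hX
  exact hX.le

end Summit.BirchSwinnertonDyer.BirchSwinnertonDyer.Theorems

end
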